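import Literature.LinearAlgebra.Matrix.RankOneHermitianColumnNorm
import HarnessLib

/-!
# The eigenline projector `χ_g(x)` of a form-unitary matrix `x` is self-adjoint up to `σ(χ_g(u))`
(Rogawski, *Automorphic Representations of Unitary Groups in Three Variables* (1990), §4.3 pp. 42–44, §4.9 p. 55; Kottwitz, *Stable trace
formula: elliptic singular terms*, Math. Ann. 275 (1986), §7)

Topic `LinearAlgebra/Matrix`; namespace `Literature.LinearAlgebra.Matrix`.  THEOREMS ONLY over Mathlib (+ ★ `RankOneHermitianColumnNorm` for the
ultrametric bookkeeping): no definition, no named fact, no instance, no notation, no `sorry`.  Cell `pub/hodgecm-mathlib`, F0∕P3a, topic T6 node N3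
(«`κ_v = +1` for almost all `v`», `F0/P3a/T6b-TREE.md` §9), FILE C §1: the COMMUTATIVE-RING ALGEBRA that feeds the hypotheses `P² = c P`,
`tr P = c`, `Pᴴ J P = σ(c) · J P`, «`P` integral», «`J` hermitian» of ★ `exists_norm_mul_unit_eq_conjTranspose_mul_mul_apply` ∕ ★
`valuation_columnHermitianValue_eq_one` (FILE B) from the data of a matching pair `ι_v(γ_H) ↔ γ̄_v` (★ `Rogawski1990.FinExplicitTransferFactor`:
`P = P_v(γ_H, γ̄_v) = x² − tr(g)·x + det(g)·1`, `x = γ̄_v` unitary for `J = H′_v`, `x P = u P`, `σ(u) u = 1`).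

SETTING.  `R` a commutative ring, `σ : R →+* R`, square matrices over `R` indexed by a finite type `n`; `Mᴴ := (M.map σ)ᵀ`.

RESULTS.
* `conjTranspose_mul_form_mul_eq_smul_of_unitary` **(self-adjointness)**: if `xᴴ J x = J`, `x P = U P` and `σ(U) U = 1`, then for
  `P = x² − T x + D·1` one has `Pᴴ J P = σ(U² − T U + D) · (J P)` — eigenvalue-free form of «the `u`-eigenline of a unitary `x` is `J`-orthogonal
  to the other eigenlines» (no field, no diagonalisation: `P = σ(U)·xP` and `xᴴ J x = J` give `xᴴ J P = σ(U)·J P`).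
* `mul_self_eq_trace_smul_of_eq_vecMulVec` **(rank one)**: `P = p qᵀ ⇒ P² = tr(P) · P`.
* `conjTranspose_mul_mul_apply_eq_sum_sum`: `(Pᴴ J P)_{jj} = Σ_i Σ_k σ(P_{ij}) J_{ik} P_{kj}` — the shape of ★ `Rogawski1990.finColumnFormValue` ∕ of
  the hypothesis `hx` of ★ `Rogawski1990.finKappaAt_eq_one_of_eigenvector_of_exists`.
* `transpose_map_map_eq_of_transpose_map_eq` **(hermitian transport)**: `(H.map c)ᵀ = H` and `σ' ∘ φ = φ ∘ c` give `((H.map φ).map σ')ᵀ = H.map φ`.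
* `valuation_projector_apply_le_one` **(integrality)**: over a field with a valuation, `x`, `T`, `D` integral ⇒ `x² − T x + D·1` integral.

## References
* J. D. Rogawski, *Automorphic Representations of Unitary Groups in Three Variables*, Ann. of Math. Stud. 123 (1990), §4.3 pp. 42–44, §4.9 p. 55
  [Rogawski1990].
* R. E. Kottwitz, *Stable trace formula: elliptic singular terms*, Math. Ann. 275 (1986), §7 [Kottwitz1986].
-/

set_option autoImplicit false

open Matrix
open scoped Matrix

namespace Literature.LinearAlgebra.Matrix

section CommRing

variable {R : Type*} [CommRing R] {n : Type*} [Fintype n] [DecidableEq n]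

/-! ## §1 Self-adjointness of `P = x² − T x + D` for a `J`-unitary `x` with `x P = U P`, `σ(U) U = 1` -/

/-- `ᴴ` of the projector polynomial: `((x² − T x + D·1).map σ)ᵀ = xᴴ xᴴ − σ(T) xᴴ + σ(D)·1` (`xᴴ = (x.map σ)ᵀ`). [cite: Rogawski1990, §4.9 p. 55] -/
theorem transpose_map_projector (σ : R →+* R) (x : Matrix n n R) (T D : R) :
    ((x * x - T • x + D • (1 : Matrix n n R)).map σ)ᵀ =
      (x.map σ)ᵀ * (x.map σ)ᵀ - σ T • (x.map σ)ᵀ + σ D • (1 : Matrix n n R) := by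
  ext i j
  have h1 : σ ((1 : Matrix n n R) j i) = (1 : Matrix n n R) i j := by
    by_cases hij : i = j
    · subst hij
      rw [Matrix.one_apply_eq, map_one]
    · rw [Matrix.one_apply_ne hij, Matrix.one_apply_ne (Ne.symm hij), map_zero]
  simp only [Matrix.transpose_apply, Matrix.map_apply, Matrix.add_apply, Matrix.sub_apply, Matrix.smul_apply, Matrix.mul_apply,
    smul_eq_mul, map_add, map_sub, map_mul, map_sum, h1]
  congr 2
  exact Finset.sum_congr rfl fun k _ => mul_comm _ _

omit [DecidableEq n] in
/-- `xᴴ J P = σ(U) · J P` when `xᴴ J x = J`, `x P = U P`, `σ(U) U = 1` (insert `P = σ(U)·x P`). [cite: Rogawski1990, §4.3 p. 42] -/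
theorem conjTranspose_mul_form_mul_eq_smul (σ : R →+* R) {J x P : Matrix n n R} {U : R}
    (hx : (x.map σ)ᵀ * J * x = J) (hxP : x * P = U • P) (hU : σ U * U = 1) :
    (x.map σ)ᵀ * J * P = σ U • (J * P) := by
  have hPU : P = σ U • (x * P) := by rw [hxP, smul_smul, hU, one_smul]
  conv_lhs => rw [hPU]
  rw [Matrix.mul_smul, ← Matrix.mul_assoc, hx]

omit [DecidableEq n] in
/-- `xᴴ xᴴ J P = σ(U)² · J P` (iterate). [cite: Rogawski1990, §4.3 p. 42] -/
theorem conjTranspose_mul_conjTranspose_mul_form_mul_eq_smul (σ : R →+* R) {J x P : Matrix n n R} {U : R}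
    (hx : (x.map σ)ᵀ * J * x = J) (hxP : x * P = U • P) (hU : σ U * U = 1) :
    (x.map σ)ᵀ * (x.map σ)ᵀ * J * P = (σ U * σ U) • (J * P) := by
  have h1 := conjTranspose_mul_form_mul_eq_smul σ hx hxP hU
  calc (x.map σ)ᵀ * (x.map σ)ᵀ * J * P = (x.map σ)ᵀ * ((x.map σ)ᵀ * J * P) := by
        simp only [Matrix.mul_assoc]
    _ = σ U • ((x.map σ)ᵀ * J * P) := by rw [h1, Matrix.mul_smul, ← Matrix.mul_assoc, h1]
    _ = (σ U * σ U) • (J * P) := by rw [h1, smul_smul]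

/-- **SELF-ADJOINTNESS OF THE EIGENLINE PROJECTOR.**  For `x` unitary for `J` (`xᴴ J x = J`, `xᴴ = (x.map σ)ᵀ`), `P = x² − T·x + D·1` with
`x P = U·P` (the columns of `P` are `U`-eigenvectors of `x`) and `σ(U)·U = 1`:  `Pᴴ J P = σ(U² − T U + D) · (J P)`.  In the application
`P = P_v(γ_H, γ̄_v) = χ_g(γ̄_v)`, `U = u = γ₂`, `U² − TU + D = χ_g(u)`: the `u`-eigenline of `γ̄_v` is `H′_v`-orthogonal to the other two eigenlines —
the hypothesis `hsa` of ★ `exists_norm_mul_unit_eq_conjTranspose_mul_mul_apply`. [cite: Rogawski1990, §4.3 pp. 42–44; §4.9 p. 55] [cite: Kottwitz1986, §7] -/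
theorem conjTranspose_mul_form_mul_eq_smul_of_unitary (σ : R →+* R) {J x P : Matrix n n R} {T D U : R}
    (hx : (x.map σ)ᵀ * J * x = J) (hP : P = x * x - T • x + D • (1 : Matrix n n R)) (hxP : x * P = U • P) (hU : σ U * U = 1) :
    (P.map σ)ᵀ * J * P = σ (U * U - T * U + D) • (J * P) := by
  have h1 := conjTranspose_mul_form_mul_eq_smul σ hx hxP hU
  have h2 := conjTranspose_mul_conjTranspose_mul_form_mul_eq_smul σ hx hxP hU
  have hPt : (P.map σ)ᵀ = (x.map σ)ᵀ * (x.map σ)ᵀ - σ T • (x.map σ)ᵀ + σ D • (1 : Matrix n n R) := by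
    rw [hP]; exact transpose_map_projector σ x T D
  rw [hPt, Matrix.add_mul, Matrix.sub_mul, Matrix.add_mul, Matrix.sub_mul, Matrix.smul_mul, Matrix.smul_mul, Matrix.smul_mul,
    Matrix.smul_mul, Matrix.one_mul, h2, h1, smul_smul, map_add, map_sub, map_mul, map_mul, ← sub_smul, ← add_smul]

/-! ## §2 Rank one: `P = p qᵀ ⇒ P² = tr(P)·P` -/

omit [DecidableEq n] in
/-- **A rank-one matrix is idempotent up to its trace**: `P = p qᵀ ⇒ P·P = tr(P)·P` (`(p qᵀ)(p qᵀ) = (q·p) p qᵀ`, `tr(p qᵀ) = p·q`).  In the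
application ★ `Rogawski1990.finEigenlineProjector_eq_vecMulVec_of_isLocalNormPair` + ★ `trace_finEigenlineProjector_of_isLocalNormPair` this is
`P_v² = χ_g(u)·P_v` — the hypothesis `hPP` of ★ `exists_norm_mul_unit_eq_conjTranspose_mul_mul_apply`. [cite: Rogawski1990, §3.5 Prop. 3.5.2 (c) p. 29; §4.9 p. 55] -/
theorem mul_self_eq_trace_smul_of_eq_vecMulVec {P : Matrix n n R} {p q : n → R} (h : P = vecMulVec p q) :
    P * P = P.trace • P := by
  rw [h, Matrix.vecMulVec_mul_vecMulVec, Matrix.vecMulVec_smul, Matrix.trace_vecMulVec, dotProduct_comm]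

/-! ## §3 The diagonal entries of `Pᴴ J P` as double sums -/

omit [DecidableEq n] in
/-- `(Pᴴ J P)_{jj} = Σ_i Σ_k σ(P_{ij}) · J_{ik} · P_{kj}` — the `J`-hermitian value of the `j`-th column of `P` (★ `Rogawski1990.finColumnFormValue`; the
shape of `hx` in ★ `Rogawski1990.finKappaAt_eq_one_of_eigenvector_of_exists` with `p′ = P e_j`). [cite: Rogawski1990, §3.5 Prop. 3.5.2 (c) p. 29; §4.9 p. 55] -/
theorem conjTranspose_mul_mul_apply_eq_sum_sum (σ : R →+* R) (J P : Matrix n n R) (j : n) :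
    ((P.map σ)ᵀ * J * P) j j = ∑ i, ∑ k, σ (P i j) * J i k * P k j := by
  simp only [Matrix.mul_apply, Matrix.transpose_apply, Matrix.map_apply, Finset.sum_mul]
  rw [Finset.sum_comm]

omit [DecidableEq n] in
/-- The same double sum in the «row-first» bracketing of ★ `conjTranspose_mul_mul_apply` (FILE B): `Σ_i Σ_k σ(P_{ij}) J_{ik} P_{kj} = Σ_k (Σ_i σ(P_{ij}) J_{ik}) P_{kj}`.
[cite: Rogawski1990, §4.9 p. 55] -/
theorem sum_sum_eq_sum_sum_mul (σ : R →+* R) (J P : Matrix n n R) (j : n) :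
    ∑ i, ∑ k, σ (P i j) * J i k * P k j = ∑ k, (∑ i, σ (P i j) * J i k) * P k j := by
  simp only [Finset.sum_mul]
  rw [Finset.sum_comm]

/-! ## §4 Transport of hermitian symmetry along a ring homomorphism -/

omit [Fintype n] [DecidableEq n] in
/-- **Hermitian symmetry is transported along an equivariant ring map**: if `(H.map c)ᵀ = H` and `σ' (φ a) = φ (c a)` for all `a`, then
`((H.map φ).map σ')ᵀ = H.map φ` (in the application: `H = H′` over `L`, `c` = complex conjugation, `φ : L → L_w`, `σ' = c_w`). [cite: Rogawski1990, §4.9 p. 54] -/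
theorem transpose_map_map_eq_of_transpose_map_eq {A B : Type*} {m : Type*} (c : A → A) (φ : A → B) (σ' : B → B)
    (hφ : ∀ a, σ' (φ a) = φ (c a)) {H : Matrix m m A} (hH : (H.map c)ᵀ = H) :
    ((H.map φ).map σ')ᵀ = H.map φ := by
  ext i j
  have h := congrArg (fun M : Matrix m m A => M i j) hH
  simp only [Matrix.transpose_apply, Matrix.map_apply] at h ⊢
  rw [hφ, h]

end CommRing

/-! ## §5 Integrality of `x² − T x + D·1` -/

section Valued

variable {K : Type*} [Field K] {n : Type*} [Fintype n] [DecidableEq n]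
variable {Γ₀ : Type*} [LinearOrderedCommGroupWithZero Γ₀] (v : Valuation K Γ₀)

/-- **`x`, `T`, `D` integral ⇒ `P = x² − T x + D·1` integral** (ultrametric inequality; in the application `x = γ̄_v ∈ GL₃(𝒪_w)` and `T = tr g`,
`D = det g` are `w`-integral for almost all `v`). [cite: Kottwitz1986, §7] [cite: Rogawski1990, §4.3 p. 44] -/
theorem valuation_projector_apply_le_one {x : Matrix n n K} (hx : ∀ a b, v (x a b) ≤ 1) {T D : K} (hT : v T ≤ 1) (hD : v D ≤ 1) (i j : n) :
    v ((x * x - T • x + D • (1 : Matrix n n K)) i j) ≤ 1 := by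
  have hxx : v ((x * x) i j) ≤ 1 := by
    rw [Matrix.mul_apply]
    exact valuation_sum_mul_le_one v Finset.univ (fun k _ => hx i k) (fun k _ => hx k j)
  have hTx : v ((T • x) i j) ≤ 1 := by
    rw [Matrix.smul_apply, smul_eq_mul, map_mul]
    exact mul_le_one' hT (hx i j)
  have hD1 : v ((D • (1 : Matrix n n K)) i j) ≤ 1 := by
    rw [Matrix.smul_apply, smul_eq_mul, map_mul, Matrix.one_apply]
    split_ifs
    · rw [map_one, mul_one]; exact hD
    · rw [map_zero, mul_zero]; exact zero_le
  rw [Matrix.add_apply, Matrix.sub_apply]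
  exact (v.map_add _ _).trans (max_le ((v.map_sub _ _).trans (max_le hxx hTx)) hD1)

end Valued

end Literature.LinearAlgebra.Matrix
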